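/-
Copyright (c) 2026 the pub-hodgecm-mathlib formalisation cell (harness21).  Prover seat hodgecm-mathlib-B-p14 (g36): road «S3-tree» (LEAD F0P3a-plan (g11), architect A-p16 (g29)),
brick T1e «VALENCIES OF THE `U(3)` LATTICE TREE», FILE V3 = A TYPE-TWO VERTEX HAS `q + 1` NEIGHBOURS; 2026-09-01.  Sequel of ★ `UnitaryLatticeTreeStar` (V1) over the coordinates
of ★ `UnitaryLatticeTreeFixedCostarCoords` (F0P2-p06 (g10)).
-/
import Literature.NumberTheory.Automorphic.UnitaryLatticeTreeStar                      -- ★ T1e V1 (B-p14 (g36)): stars by type, `mem_neighborSet_N₁_iff`, transport to `N₁`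
import Literature.NumberTheory.Automorphic.UnitaryLatticeTreeFixedCostarCoords          -- ★ T2-E′ FILE 3 (F0P2-p06 (g10)): `w(a,b)` coordinates on `N₁^♯ ∕ N₁`, `isSelfDualLattice_N₁_sup_span_vec_iff`
import Literature.NumberTheory.Automorphic.UnitaryLatticeTreeResiduallyUnipotentCorner  -- ★ S-a3 (F0P3a-p07 (g11)): `residue_eq_zero_iff_v_lt_one`, `residue_eq_of_v_sub_lt_one`
import Literature.FieldTheory.FiniteFields.QuadraticTraceKernelCount                    -- ★ `natCard_traceKer` (`#{t : σt + t = 0} = q`)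
import HarnessLib

/-!
# The lattice graph of a hermitian space — T1e FILE V3: A TYPE-TWO VERTEX OF THE `U(3)` TREE HAS EXACTLY `q + 1` NEIGHBOURS (the star of `N₁ = latt diag(1,1,ϖ)` is in bijection
# with the isotropic points `[0:1]`, `[1:b]` (`σ̄b + b = 0`) of the residual hyperbolic plane `N₁^♯ ∕ N₁`) (Bruhat–Tits 1972 §10; Tits 1979 §3.5; Serre, *Trees* II.1.1)

Topic `NumberTheory/Automorphic`; namespace `Literature.NumberTheory.Automorphic.UnitaryLatticeTree`.  THEOREMS ONLY (no definition, no instance, no notation, no named fact,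
no `sorry`); kernel lane.  Cell `pub/hodgecm-mathlib` (D-0151), crux H413 = `stmt-HodgeConjecture-24833`; road «S3-tree», brick **T1e «VALENCIES»**: the number `q + 1` of
(self-dual) neighbours of a type-two vertex of the Bruhat–Tits tree of the unramified `U(3)`, in the currency of ★ `TreeDisplacementLayerCount` ED. 2 (F0P3a-p08 (g17)):
`(G.neighborSet v).Finite` and `(G.neighborSet v).ncard = q + 1`.  Companion of ★ V2b `UnitaryLatticeTreeRootStarCount` (`q³ + 1` at self-dual vertices).

THE MATHEMATICS (`K` with `Valued K ℤᵐ⁰`, `hd : UnramifiedLocalConjDatum σ ϖ`, `J₀ = antidiag(1,1,1)`, `N₁ = latt diag(1,1,ϖ)`, `N₁^♯ = latt diag(ϖ⁻¹,1,1)` (★ `dualLatt_N₁`);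
coordinates `w(a,b) = (a∕ϖ, 0, b)` of ★ F0P2-p06: every `w ∈ N₁^♯` is `≡ w(ϖw₀, w₂) (mod N₁)` (★ `sub_vec_mem_N₁_of_mem_dual`), `w(a,b) ∈ N₁ ↔ |a|, |b| < 1` (★ `vec_mem_N₁_iff`),
and «SELF-DUAL NEIGHBOURS = ISOTROPIC POINTS»: for primitive integral `(a,b)`, `N₁ + 𝒪w(a,b)` is self-dual iff `σ(a)b + σ(b)a ∈ 𝔪` (★ `isSelfDualLattice_N₁_sup_span_vec_iff`)).
By ★ V1 the star of `N₁` is the set of (self-dual) vertices `L > N₁`.  (§1) EXHAUSTION: such an `L` lies in `L^♯ ≤ N₁^♯`; a vector `w ∈ L ∖ N₁` reduces to a PRIMITIVE `w(a,b) ∈ L`,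
ISOTROPIC because `L ≤ L^♯` (`B₀(w(a,b), w(a,b)) = (σ(a)b + σ(b)a)∕ϖ ∈ 𝒪`), so `N₁ + 𝒪w(a,b) ≤ L` are two self-dual vertices, EQUAL by (D2): **`star(N₁) = {N₁ + 𝒪w(a,b) | (a,b)`
primitive isotropic`}`** (§2).  (§3) NORMALISATION: `|a| = 1` ⇒ `(a,b) ≡ a·(1, b∕a)` with `σ̄(b∕a)‾ + (b∕a)‾ = 0`; `|a| < 1` ⇒ `|b| = 1`, `(a,b) ≡ b·(0,1)`; and `N₁ + 𝒪w(a,b) = N₁ + 𝒪w(a′,b′)`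
iff `(a′,b′) ≡ c·(a,b) (mod 𝔪)` for a unit `c` (★ F0P2-p06 `sup_span_eq_sup_span_iff`), which SEPARATES the normalised representatives `(0,1)`, `(1,B)`.  Hence
`#star(N₁) = #(Option {t ∈ 𝓀 | σk t + t = 0}) = 1 + q` (★ `natCard_traceKer`: the kernel of the trace `𝔽_{q²} → 𝔽_q`), and by ★ V1 (`ncard_neighborSet_eq_ncard_neighborSet_N₁`) the
same holds at every type-two vertex (§4).

* §1 `B₀_vec_vec` (`B₀(w(a,b), w(a′,b′)) = (σ(a)b′ + σ(b)a′)∕ϖ`), `vec_sub_smul_vec`, `N₁_lt_N₁_sup_span_vec` (primitive ⇒ strictly above), **`exists_eq_N₁_sup_span_vec_of_lt`** (exhaustion).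
* §2 **`mem_neighborSet_N₁_iff_exists_vec`** (`star(N₁)` = the self-dual `N₁ + 𝒪w(a,b)`, `(a,b)` primitive isotropic).
* §3 `v_add_σ_lt_one_of_residue` (`(1,B)` is isotropic when `σk B̄ + B̄ = 0`), **`natCard_neighborSet_N₁_eq`** (`Nat.card star(N₁) = Nat.card (Option {t | σk t + t = 0})`, any residue field).
* §4 **`finite_neighborSet_N₁`**, **`ncard_neighborSet_N₁`** (`= q + 1`); **`finite_neighborSet_of_isVertexLattice_two`**, **`ncard_neighborSet_of_isVertexLattice_two`** — THE HEADS for the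
  T2-S fold: every type-two vertex `v` has a finite star with `(G.neighborSet v).ncard = q + 1`.

HONEST LABEL: HC_CM is proved only modulo the 2 remaining named inputs (hLiu418 24832, h413 24833) until rung 0 closes; nothing printed is asserted here (elementary lattice
algebra over a valuation ring and a finite-field count); S3 (`stub_N6nsS3id`) stays a print row until the road's END lands.

## References
* [BruhatTits1972] F. Bruhat, J. Tits, *Groupes réductifs sur un corps local I*, Publ. Math. IHÉS 41 (1972), §10 (the tree of a rank-one group; valencies from the residual groups).
* [Tits1979] J. Tits, *Reductive groups over local fields*, PSPM 33.1 (1979), §3.5 (the star of a vertex = the residual building: here the `q + 1` isotropic points of the residual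
  hyperbolic hermitian plane), §2.4 (quasi-split `U(3)`: local index `(q³+1, q+1)`).
* [Serre1980Trees] J.-P. Serre, *Trees* (1980), Ch. II §1.1 (neighbours of a vertex ↔ points of the projective line over the residue field).
* [Jacobowitz1962] R. Jacobowitz, *Hermitian forms over local fields*, Amer. J. Math. 84 (1962), §7–§8 (unimodular ∕ `𝔭`-modular hermitian lattices and their neighbours).
-/

set_option autoImplicit false

noncomputable section

open scoped Valued WithZero Matrix MatrixGroups

namespace Literature.NumberTheory.Automorphic.UnitaryLatticeTree

open Literature.NumberTheory.Automorphic Literature.NumberTheory.Automorphic.HermitianLattice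
open Literature.NumberTheory.Automorphic.CartanUnique Literature.FieldTheory.FiniteFields

variable {K : Type*} [Field K] [Valued K ℤᵐ⁰] {σ : K →+* K} {ϖ : K}

/-! ## §1 The coordinate vectors `w(a,b) = (a∕ϖ, 0, b)`: pairing, differences, and the exhaustion of the star of `N₁` -/

omit [Valued K ℤᵐ⁰] in
/-- **The residual form of `N₁^♯ ∕ N₁`**: `B₀(w(a,b), w(a′,b′)) = (σ(a)b′ + σ(b)a′)∕ϖ` (`σϖ = ϖ ≠ 0`). [cite: Jacobowitz1962, §7–§8] [cite: BruhatTits1972, §10] -/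
theorem B₀_vec_vec (hσϖ : σ ϖ = ϖ) (hϖ0 : ϖ ≠ 0) (a b a' b' : K) :
    B₀ σ 3 (![a / ϖ, 0, b] : Fin 3 → K) ![a' / ϖ, 0, b'] = (σ a * b' + σ b * a') / ϖ := by
  rw [UnitaryGroup.B₀_three_apply]
  simp [map_div₀, hσϖ]
  field_simp

omit [Valued K ℤᵐ⁰] in
/-- `w(a′,b′) − c·w(a,b) = w(a′ − ca, b′ − cb)`. [cite: Serre1980Trees, II.1.1] -/
theorem vec_sub_smul_vec (a b a' b' c : K) :
    (![a' / ϖ, 0, b'] : Fin 3 → K) - c • ![a / ϖ, 0, b] = ![(a' - c * a) / ϖ, 0, b' - c * b] := by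
  ext i
  fin_cases i
  · simp; ring
  · simp
  · simp

/-- **A primitive `w(a,b)` lies strictly above `N₁`**: `N₁ < N₁ + 𝒪w(a,b)` when `|a| = 1 ∨ |b| = 1` (★ `vec_mem_N₁_iff`). [cite: BruhatTits1972, §10] [cite: Serre1980Trees, II.1.1] -/
theorem N₁_lt_N₁_sup_span_vec (hϖ : Valued.v ϖ = WithZero.exp (-1 : ℤ)) {a b : K} (hprim : Valued.v a = 1 ∨ Valued.v b = 1) :
    latt (Matrix.diagonal ![(1 : K), 1, ϖ]) < latt (Matrix.diagonal ![(1 : K), 1, ϖ]) ⊔ Submodule.span 𝒪[K] {(![a / ϖ, 0, b] : Fin 3 → K)} := by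
  refine lt_of_le_of_ne le_sup_left fun hEq => ?_
  have hw : (![a / ϖ, 0, b] : Fin 3 → K) ∈ latt (Matrix.diagonal ![(1 : K), 1, ϖ]) := by
    rw [hEq]; exact Submodule.mem_sup_right (Submodule.mem_span_singleton_self _)
  obtain ⟨ha, hb⟩ := (vec_mem_N₁_iff hϖ a b).1 hw
  rcases hprim with h | h
  · exact absurd h ha.ne
  · exact absurd h hb.ne

/-- **EXHAUSTION OF THE STAR OF `N₁`**: a self-dual vertex `L > N₁` is `N₁ + 𝒪w(a,b)` for a PRIMITIVE integral pair `(a,b)` with `σ(a)b + σ(b)a ∈ 𝔪` — `L ≤ L^♯ ≤ N₁^♯`, a vector of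
`L ∖ N₁` reduces to a primitive `w(a,b) ∈ L` (★ `sub_vec_mem_N₁_of_mem_dual`), isotropic since `L ≤ L^♯`, and `N₁ + 𝒪w(a,b) ≤ L` are two self-dual vertices
(★ `isSelfDualLattice_N₁_sup_span_vec_iff`), equal by (D2). [cite: BruhatTits1972, §10] [cite: Jacobowitz1962, §7–§8] [cite: Serre1980Trees, II.1.1] -/
theorem exists_eq_N₁_sup_span_vec_of_lt (hd : UnramifiedLocalConjDatum σ ϖ) {L : Submodule 𝒪[K] (Fin 3 → K)}
    (hL : IsSelfDualLattice σ ϖ ((StdForm.antidiagonal 3).over K) L) (hlt : latt (Matrix.diagonal ![(1 : K), 1, ϖ]) < L) :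
    ∃ a b : K, Valued.v a ≤ 1 ∧ Valued.v b ≤ 1 ∧ (Valued.v a = 1 ∨ Valued.v b = 1) ∧ Valued.v (σ a * b + σ b * a) < 1 ∧
      L = latt (Matrix.diagonal ![(1 : K), 1, ϖ]) ⊔ Submodule.span 𝒪[K] {(![a / ϖ, 0, b] : Fin 3 → K)} := by
  have hϖ0 : ϖ ≠ 0 := uniformizer_ne_zero hd.vϖ
  have hvϖ0 : Valued.v ϖ ≠ 0 := (Valuation.ne_zero_iff _).2 hϖ0
  have hlt1 : ∀ z : K, Valued.v z < 1 ↔ Valued.v z ≤ Valued.v ϖ := fun z => by rw [hd.vϖ]; exact v_lt_one_iff z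
  -- `L ≤ L^♯ ≤ N₁^♯ = latt diag(ϖ⁻¹, 1, 1)`
  have hLd : L ≤ latt (Matrix.diagonal ![ϖ⁻¹, (1 : K), 1]) :=
    calc L ≤ dualLatt σ ((StdForm.antidiagonal 3).over K) L := le_dualLatt_of_isVertexLattice hd.vσ hL
      _ ≤ dualLatt σ ((StdForm.antidiagonal 3).over K) (latt (Matrix.diagonal ![(1 : K), 1, ϖ])) := dualLatt_antitone σ _ hlt.le
      _ = latt (Matrix.diagonal ![ϖ⁻¹, (1 : K), 1]) := by rw [dualLatt_N₁ hd.vσ hd.σϖ hϖ0, zpow_neg_one]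
  obtain ⟨w, hwL, hwN⟩ := SetLike.exists_of_lt hlt
  obtain ⟨ha, hb, hsub⟩ := sub_vec_mem_N₁_of_mem_dual hd.vϖ (hLd hwL)
  -- `w(a,b) ∈ L`, primitive, isotropic
  have hw'L : (![ϖ * w 0 / ϖ, 0, w 2] : Fin 3 → K) ∈ L := by
    have h : w - (w - ![ϖ * w 0 / ϖ, 0, w 2]) ∈ L := Submodule.sub_mem _ hwL (hlt.le hsub)
    rwa [sub_sub_cancel] at h
  have hprim : Valued.v (ϖ * w 0) = 1 ∨ Valued.v (w 2) = 1 := by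
    by_contra h
    push Not at h
    have hmem : (![ϖ * w 0 / ϖ, 0, w 2] : Fin 3 → K) ∈ latt (Matrix.diagonal ![(1 : K), 1, ϖ]) :=
      (vec_mem_N₁_iff hd.vϖ _ _).2 ⟨lt_of_le_of_ne ha h.1, lt_of_le_of_ne hb h.2⟩
    have hw : w ∈ latt (Matrix.diagonal ![(1 : K), 1, ϖ]) := by
      have := Submodule.add_mem _ hsub hmem
      rwa [sub_add_cancel] at this
    exact hwN hw
  have hiso : Valued.v (σ (ϖ * w 0) * w 2 + σ (w 2) * (ϖ * w 0)) < 1 := by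
    have h1 := (mem_dualLatt σ _ L _).1 (le_dualLatt_of_isVertexLattice hd.vσ hL hw'L) _ hw'L
    rw [pairing_antidiagonal, B₀_vec_vec hd.σϖ hϖ0, map_div₀, div_le_one₀ (zero_lt_iff.2 hvϖ0)] at h1
    exact (hlt1 _).2 h1
  -- `N₁ + 𝒪w(a,b) ≤ L`, both self-dual
  have hL' := (isSelfDualLattice_N₁_sup_span_vec_iff hd.σσ hd.vσ hd.σϖ hd.vϖ ha hb hprim).2 hiso
  have hle : latt (Matrix.diagonal ![(1 : K), 1, ϖ]) ⊔ Submodule.span 𝒪[K] {(![ϖ * w 0 / ϖ, 0, w 2] : Fin 3 → K)} ≤ L :=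
    sup_le hlt.le (Submodule.span_le.2 (Set.singleton_subset_iff.2 hw'L))
  exact ⟨ϖ * w 0, w 2, ha, hb, hprim, hiso, (eq_of_le_of_isVertexLattice hd.vσ hϖ0 hL' hL hle).symm⟩

/-! ## §2 The star of `N₁` = the self-dual lattices `N₁ + 𝒪w(a,b)`, `(a,b)` primitive isotropic -/

/-- **`star(N₁) = {N₁ + 𝒪w(a,b) | (a,b) ∈ 𝒪² primitive, σ(a)b + σ(b)a ∈ 𝔪}`**. [cite: BruhatTits1972, §10] [cite: Tits1979, §3.5] [cite: Serre1980Trees, II.1.1] -/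
theorem mem_neighborSet_N₁_iff_exists_vec (hd : UnramifiedLocalConjDatum σ ϖ)
    (w : {M : Submodule 𝒪[K] (Fin 3 → K) // IsVertex σ ϖ ((StdForm.antidiagonal 3).over K) M}) :
    w ∈ (latticeGraph σ ϖ ((StdForm.antidiagonal 3).over K)).neighborSet
        ⟨latt (Matrix.diagonal ![(1 : K), 1, ϖ]), 2,
          isVertexLattice_two_latt_diagonal_one_one hd.σϖ (uniformizer_mem_integer hd.vϖ) (uniformizer_ne_zero hd.vϖ)⟩ ↔
      ∃ a b : K, Valued.v a ≤ 1 ∧ Valued.v b ≤ 1 ∧ (Valued.v a = 1 ∨ Valued.v b = 1) ∧ Valued.v (σ a * b + σ b * a) < 1 ∧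
        w.1 = latt (Matrix.diagonal ![(1 : K), 1, ϖ]) ⊔ Submodule.span 𝒪[K] {(![a / ϖ, 0, b] : Fin 3 → K)} := by
  rw [mem_neighborSet_N₁_iff hd]
  constructor
  · intro hlt
    have h0 : IsSelfDualLattice σ ϖ ((StdForm.antidiagonal 3).over K) w.1 :=
      (isVertexLattice_two_and_isSelfDualLattice_of_lt hd
        ⟨2, isVertexLattice_two_latt_diagonal_one_one hd.σϖ (uniformizer_mem_integer hd.vϖ) (uniformizer_ne_zero hd.vϖ)⟩ w.2 hlt).2
    exact exists_eq_N₁_sup_span_vec_of_lt hd h0 hlt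
  · rintro ⟨a, b, -, -, hprim, -, hw⟩
    rw [hw]
    exact N₁_lt_N₁_sup_span_vec hd.vϖ hprim

/-! ## §3 The bijection with the normalised residual parameters `[0:1]`, `[1:t]` (`σk t + t = 0`) -/

/-- **`(1, B)` is an isotropic point when `σk B̄ + B̄ = 0`**: `σ(1)·B + σ(B)·1 = B + σB ∈ 𝔪`. [cite: Tits1979, §3.5] [cite: Serre1980Trees, II.1.1] -/
theorem v_add_σ_lt_one_of_residue (hσO : ∀ x : 𝒪[K], σ x ∈ 𝒪[K]) (σk : 𝓀[K] →+* 𝓀[K])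
    (hσk : ∀ x : 𝒪[K], IsLocalRing.residue 𝒪[K] ⟨σ x, hσO x⟩ = σk (IsLocalRing.residue 𝒪[K] x)) {B : 𝒪[K]}
    (hB : σk (IsLocalRing.residue 𝒪[K] B) + IsLocalRing.residue 𝒪[K] B = 0) :
    Valued.v (σ (1 : K) * (B : K) + σ (B : K) * 1) < 1 := by
  have hcoe : σ (1 : K) * (B : K) + σ (B : K) * 1 = ((⟨σ (B : K), hσO B⟩ + B : 𝒪[K]) : K) := by rw [map_one]; simp; ring
  rw [hcoe, ← residue_eq_zero_iff_v_lt_one, map_add, hσk]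
  exact hB

/-- **THE STAR OF `N₁` ↔ THE ISOTROPIC POINTS OF THE RESIDUAL HYPERBOLIC PLANE, NORMALISED**: `#star(N₁) = #(Option {t ∈ 𝓀 | σk t + t = 0})` — the point `[0:1]` (the neighbour
`N₁ + 𝒪e₂ = L₀`) and the points `[1:t]` (the neighbours `N₁ + 𝒪w(1,B)`).  Valid for ANY residue field and any reduction `σk` of `σ`.
[cite: BruhatTits1972, §10] [cite: Tits1979, §3.5] [cite: Serre1980Trees, II.1.1] -/
theorem natCard_neighborSet_N₁_eq (hd : UnramifiedLocalConjDatum σ ϖ) (hσO : ∀ x : 𝒪[K], σ x ∈ 𝒪[K]) (σk : 𝓀[K] →+* 𝓀[K])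
    (hσk : ∀ x : 𝒪[K], IsLocalRing.residue 𝒪[K] ⟨σ x, hσO x⟩ = σk (IsLocalRing.residue 𝒪[K] x)) :
    Nat.card ((latticeGraph σ ϖ ((StdForm.antidiagonal 3).over K)).neighborSet
        ⟨latt (Matrix.diagonal ![(1 : K), 1, ϖ]), 2,
          isVertexLattice_two_latt_diagonal_one_one hd.σϖ (uniformizer_mem_integer hd.vϖ) (uniformizer_ne_zero hd.vϖ)⟩) =
      Nat.card (Option {t : 𝓀[K] // σk t + t = 0}) := by
  classical
  have hϖ0 : ϖ ≠ 0 := uniformizer_ne_zero hd.vϖ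
  have h0 : Valued.v (0 : K) < 1 := by rw [map_zero]; exact zero_lt_one
  obtain ⟨lift, hlift⟩ : ∃ lift : 𝓀[K] → 𝒪[K], ∀ a, IsLocalRing.residue 𝒪[K] (lift a) = a :=
    ⟨Function.surjInv IsLocalRing.residue_surjective, Function.surjInv_eq IsLocalRing.residue_surjective⟩
  -- the normalised pairs `(a_p, b_p)`: `(0, 1)` and `(1, lift t)`
  let aOf : Option {t : 𝓀[K] // σk t + t = 0} → K := fun p => p.elim 0 fun _ => 1
  let bOf : Option {t : 𝓀[K] // σk t + t = 0} → K := fun p => p.elim 1 fun t => (lift t.1 : K)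
  have ha_none : aOf none = 0 := rfl
  have hb_none : bOf none = 1 := rfl
  have ha_some : ∀ t, aOf (some t) = 1 := fun _ => rfl
  have hb_some : ∀ t, bOf (some t) = (lift t.1 : K) := fun _ => rfl
  have ha : ∀ p, Valued.v (aOf p) ≤ 1 := by
    rintro (_ | t)
    · rw [ha_none, map_zero]; exact zero_le_one
    · rw [ha_some, map_one]
  have hb : ∀ p, Valued.v (bOf p) ≤ 1 := by
    rintro (_ | t)
    · rw [hb_none, map_one]
    · rw [hb_some]; exact (lift t.1).2
  have hprim : ∀ p, Valued.v (aOf p) = 1 ∨ Valued.v (bOf p) = 1 := by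
    rintro (_ | t)
    · exact Or.inr (by rw [hb_none, map_one])
    · exact Or.inl (by rw [ha_some, map_one])
  have hiso : ∀ p, Valued.v (σ (aOf p) * bOf p + σ (bOf p) * aOf p) < 1 := by
    rintro (_ | t)
    · rw [ha_none, hb_none]; simp
    · rw [ha_some, hb_some]
      refine v_add_σ_lt_one_of_residue hσO σk hσk ?_
      rw [hlift]; exact t.2
  -- the vertices `N₁ + 𝒪w(a_p, b_p)` of the star
  have hsd : ∀ p, IsSelfDualLattice σ ϖ ((StdForm.antidiagonal 3).over K)
      (latt (Matrix.diagonal ![(1 : K), 1, ϖ]) ⊔ Submodule.span 𝒪[K] {(![aOf p / ϖ, 0, bOf p] : Fin 3 → K)}) := fun p =>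
    (isSelfDualLattice_N₁_sup_span_vec_iff hd.σσ hd.vσ hd.σϖ hd.vϖ (ha p) (hb p) (hprim p)).2 (hiso p)
  let f : Option {t : 𝓀[K] // σk t + t = 0} →
      (latticeGraph σ ϖ ((StdForm.antidiagonal 3).over K)).neighborSet
        ⟨latt (Matrix.diagonal ![(1 : K), 1, ϖ]), 2,
          isVertexLattice_two_latt_diagonal_one_one hd.σϖ (uniformizer_mem_integer hd.vϖ) (uniformizer_ne_zero hd.vϖ)⟩ := fun p =>
    ⟨⟨latt (Matrix.diagonal ![(1 : K), 1, ϖ]) ⊔ Submodule.span 𝒪[K] {(![aOf p / ϖ, 0, bOf p] : Fin 3 → K)}, 0, hsd p⟩,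
      (mem_neighborSet_N₁_iff hd _).2 (N₁_lt_N₁_sup_span_vec hd.vϖ (hprim p))⟩
  have hf : ∀ p, (f p).1.1 = latt (Matrix.diagonal ![(1 : K), 1, ϖ]) ⊔ Submodule.span 𝒪[K] {(![aOf p / ϖ, 0, bOf p] : Fin 3 → K)} := fun _ => rfl
  -- `w(a_p, b_p)` is level one over `N₁`
  have hlev : ∀ p, ϖ • (![aOf p / ϖ, 0, bOf p] : Fin 3 → K) ∈ latt (Matrix.diagonal ![(1 : K), 1, ϖ]) := fun p => smul_ϖ_vec_mem_N₁ hd.vϖ (ha p) (hb p)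
  have hnot : ∀ p, (![aOf p / ϖ, 0, bOf p] : Fin 3 → K) ∉ latt (Matrix.diagonal ![(1 : K), 1, ϖ]) := fun p hmem => by
    obtain ⟨h1, h2⟩ := (vec_mem_N₁_iff hd.vϖ _ _).1 hmem
    rcases hprim p with h | h
    · exact absurd h h1.ne
    · exact absurd h h2.ne
  refine (Nat.card_congr (Equiv.ofBijective f ⟨?_, ?_⟩)).symm
  · -- injective: equal lattices ⇒ proportional residual pairs ⇒ equal normalised parameters
    intro p p' hpp'
    have hEq : (f p').1.1 = (f p).1.1 := by rw [hpp']
    rw [hf, hf] at hEq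
    obtain ⟨c, hc, hmem⟩ := (sup_span_eq_sup_span_iff hd.vϖ (hlev p) (hnot p')).1 hEq
    rw [vec_sub_smul_vec, vec_mem_N₁_iff hd.vϖ] at hmem
    obtain ⟨h1, h2⟩ := hmem
    rcases p with _ | ⟨t, ht⟩ <;> rcases p' with _ | ⟨t', ht'⟩
    · rfl
    · rw [ha_none, ha_some, mul_zero, sub_zero, map_one] at h1
      exact absurd h1 (lt_irrefl 1)
    · rw [ha_some, ha_none, mul_one, zero_sub, Valuation.map_neg, hc] at h1
      exact absurd h1 (lt_irrefl 1)
    · rw [ha_some, ha_some, mul_one] at h1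
      rw [hb_some, hb_some] at h2
      -- `|B′ − B| ≤ max(|B′ − cB|, |(c − 1)B|) < 1`
      have h3 : Valued.v ((lift t' : K) - (lift t : K)) < 1 := by
        have e : (lift t' : K) - (lift t : K) = ((lift t' : K) - c * (lift t : K)) + (c - 1) * (lift t : K) := by ring
        rw [e]
        refine (Valuation.map_add _ _ _).trans_lt (max_lt h2 ?_)
        rw [map_mul, ← Valuation.map_neg, neg_sub]
        calc Valued.v (1 - c) * Valued.v (lift t : K) ≤ Valued.v (1 - c) * 1 := mul_le_mul_right (lift t).2 _
          _ < 1 := by rw [mul_one]; exact h1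
      have h4 := residue_eq_of_v_sub_lt_one h3
      rw [hlift, hlift] at h4
      subst h4
      rfl
  · -- surjective: every vertex of the star is `N₁ + 𝒪w(a_p, b_p)` for a normalised `p`
    rintro ⟨w, hw⟩
    obtain ⟨a, b, ha', hb', hprim', hiso', hw1⟩ := (mem_neighborSet_N₁_iff_exists_vec hd w).1 hw
    -- it suffices to exhibit `p` and a unit `c` with `w(a,b) − c·w(a_p,b_p) ∈ N₁`
    have key : ∀ p (c : K), Valued.v c = 1 → Valued.v (a - c * aOf p) < 1 → Valued.v (b - c * bOf p) < 1 → f p = ⟨w, hw⟩ := by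
      intro p c hc h1 h2
      apply Subtype.ext; apply Subtype.ext
      rw [hf, hw1]
      refine (sup_span_eq_sup_span_of_sub_mem hc ?_).symm
      rw [vec_sub_smul_vec, vec_mem_N₁_iff hd.vϖ]
      exact ⟨h1, h2⟩
    by_cases ha1 : Valued.v a = 1
    · -- `|a| = 1`: `p = [1 : b∕a]`
      have ha0 : a ≠ 0 := fun h => by rw [h, map_zero] at ha1; exact zero_ne_one ha1
      have hσa0 : σ a ≠ 0 := (map_ne_zero σ).2 ha0
      have hBint : Valued.v (b / a) ≤ 1 := by rw [map_div₀, ha1, div_one]; exact hb'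
      set B : 𝒪[K] := ⟨b / a, hBint⟩ with hBdef
      have ht : σk (IsLocalRing.residue 𝒪[K] B) + IsLocalRing.residue 𝒪[K] B = 0 := by
        rw [← hσk, ← map_add, residue_eq_zero_iff_v_lt_one]
        change Valued.v (σ (b / a) + b / a) < 1
        have e : σ (b / a) + b / a = (σ a * b + σ b * a) / (σ a * a) := by rw [map_div₀]; field_simp; ring
        rw [e, map_div₀, map_mul, hd.vσ, ha1, mul_one, div_one]
        exact hiso'
      refine ⟨some ⟨_, ht⟩, key _ a ha1 ?_ ?_⟩
      · rw [ha_some, mul_one, sub_self]; exact h0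
      · rw [hb_some]
        have e : b - a * (lift (IsLocalRing.residue 𝒪[K] B) : K) = a * ((B : K) - (lift (IsLocalRing.residue 𝒪[K] B) : K)) := by
          change b - a * _ = a * (b / a - _)
          field_simp
        rw [e, map_mul, ha1, one_mul, show (B : K) - (lift (IsLocalRing.residue 𝒪[K] B) : K) = ((B - lift (IsLocalRing.residue 𝒪[K] B) : 𝒪[K]) : K) from rfl,
          ← residue_eq_zero_iff_v_lt_one, map_sub, hlift, sub_self]
    · -- `|a| < 1`: then `|b| = 1` and `p = [0 : 1]`
      have hb1 : Valued.v b = 1 := hprim'.resolve_left ha1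
      refine ⟨none, key none b hb1 ?_ ?_⟩
      · rw [ha_none, mul_zero, sub_zero]; exact lt_of_le_of_ne ha' ha1
      · rw [hb_none, mul_one, sub_self]; exact h0

/-! ## §4 The counts: `q + 1` neighbours at every type-two vertex -/

/-- **The star of `N₁` is finite** (finite residue field; any reduction `σk` of `σ`). [cite: BruhatTits1972, §10] [cite: Serre1980Trees, II.1.1] -/
theorem finite_neighborSet_N₁ (hd : UnramifiedLocalConjDatum σ ϖ) (hσO : ∀ x : 𝒪[K], σ x ∈ 𝒪[K]) (σk : 𝓀[K] →+* 𝓀[K])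
    (hσk : ∀ x : 𝒪[K], IsLocalRing.residue 𝒪[K] ⟨σ x, hσO x⟩ = σk (IsLocalRing.residue 𝒪[K] x)) [Finite 𝓀[K]] :
    ((latticeGraph σ ϖ ((StdForm.antidiagonal 3).over K)).neighborSet
        ⟨latt (Matrix.diagonal ![(1 : K), 1, ϖ]), 2,
          isVertexLattice_two_latt_diagonal_one_one hd.σϖ (uniformizer_mem_integer hd.vϖ) (uniformizer_ne_zero hd.vϖ)⟩).Finite := by
  have h := natCard_neighborSet_N₁_eq hd hσO σk hσk
  rw [Finite.card_option] at h
  exact Set.finite_coe_iff.1 (Nat.finite_of_card_ne_zero (by rw [h]; exact Nat.succ_ne_zero _))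

/-- **THE STAR OF `N₁` HAS `q + 1` VERTICES** (`|𝓀| = q²`, `σk` the `q`-Frobenius: the `q + 1` isotropic points of the residual hyperbolic plane, via ★ `natCard_traceKer`).
[cite: BruhatTits1972, §10] [cite: Tits1979, §3.5 and §2.4] [cite: Serre1980Trees, II.1.1] -/
theorem ncard_neighborSet_N₁ (hd : UnramifiedLocalConjDatum σ ϖ) (hσO : ∀ x : 𝒪[K], σ x ∈ 𝒪[K]) (σk : 𝓀[K] →+* 𝓀[K])
    (hσk : ∀ x : 𝒪[K], IsLocalRing.residue 𝒪[K] ⟨σ x, hσO x⟩ = σk (IsLocalRing.residue 𝒪[K] x))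
    [Fintype 𝓀[K]] {q : ℕ} (hk : Fintype.card 𝓀[K] = q ^ 2) (hfrob : ∀ y, σk y = y ^ q) :
    ((latticeGraph σ ϖ ((StdForm.antidiagonal 3).over K)).neighborSet
        ⟨latt (Matrix.diagonal ![(1 : K), 1, ϖ]), 2,
          isVertexLattice_two_latt_diagonal_one_one hd.σϖ (uniformizer_mem_integer hd.vϖ) (uniformizer_ne_zero hd.vϖ)⟩).ncard = q + 1 := by
  rw [← Nat.card_coe_set_eq, natCard_neighborSet_N₁_eq hd hσO σk hσk, Finite.card_option, natCard_traceKer hk σk hfrob]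

/-- **The star of every type-two vertex is finite** (the `hnb` of ★ `TreeDisplacementLayerCount` ED. 2 at type `2`). [cite: BruhatTits1972, §10] [cite: Serre1980Trees, II.1.1] -/
theorem finite_neighborSet_of_isVertexLattice_two (hd : UnramifiedLocalConjDatum σ ϖ) (hσO : ∀ x : 𝒪[K], σ x ∈ 𝒪[K]) (σk : 𝓀[K] →+* 𝓀[K])
    (hσk : ∀ x : 𝒪[K], IsLocalRing.residue 𝒪[K] ⟨σ x, hσO x⟩ = σk (IsLocalRing.residue 𝒪[K] x)) [Finite 𝓀[K]]
    (v : {M : Submodule 𝒪[K] (Fin 3 → K) // IsVertex σ ϖ ((StdForm.antidiagonal 3).over K) M})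
    (hv : IsVertexLattice σ ϖ ((StdForm.antidiagonal 3).over K) 2 v.1) :
    ((latticeGraph σ ϖ ((StdForm.antidiagonal 3).over K)).neighborSet v).Finite :=
  (finite_neighborSet_iff_N₁ hd v hv).2 (finite_neighborSet_N₁ hd hσO σk hσk)

/-- **EVERY TYPE-TWO VERTEX OF THE `U(3)` TREE HAS EXACTLY `q + 1` NEIGHBOURS** (all self-dual) — the valency `q (c v) + 1 = q + 1` of ★ `TreeDisplacementLayerCount` ED. 2 ∕
★ `TreeLayers.ncard_layer_succ_inter_type_eq` at the non-hyperspecial type, for the unramified `U(3)` with residue field of the quadratic extension of order `q²`.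
[cite: BruhatTits1972, §10] [cite: Tits1979, §3.5 and §2.4] [cite: Serre1980Trees, II.1.1] -/
theorem ncard_neighborSet_of_isVertexLattice_two (hd : UnramifiedLocalConjDatum σ ϖ) (hσO : ∀ x : 𝒪[K], σ x ∈ 𝒪[K]) (σk : 𝓀[K] →+* 𝓀[K])
    (hσk : ∀ x : 𝒪[K], IsLocalRing.residue 𝒪[K] ⟨σ x, hσO x⟩ = σk (IsLocalRing.residue 𝒪[K] x))
    [Fintype 𝓀[K]] {q : ℕ} (hk : Fintype.card 𝓀[K] = q ^ 2) (hfrob : ∀ y, σk y = y ^ q)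
    (v : {M : Submodule 𝒪[K] (Fin 3 → K) // IsVertex σ ϖ ((StdForm.antidiagonal 3).over K) M})
    (hv : IsVertexLattice σ ϖ ((StdForm.antidiagonal 3).over K) 2 v.1) :
    ((latticeGraph σ ϖ ((StdForm.antidiagonal 3).over K)).neighborSet v).ncard = q + 1 := by
  rw [ncard_neighborSet_eq_ncard_neighborSet_N₁ hd v hv, ncard_neighborSet_N₁ hd hσO σk hσk hk hfrob]

end Literature.NumberTheory.Automorphic.UnitaryLatticeTree

end
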